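import Mathlib
import Summits.ResolutionOfSingularities.ResolutionOfSingularities.Theorems.RadicialJungCleanModelsCleanLU3CompositeResidue
import Summits.ResolutionOfSingularities.ResolutionOfSingularities.Theorems.RadicialJungCleanModelsCleanLU3CompositeRamified
import Summits.ResolutionOfSingularities.ResolutionOfSingularities.Theorems.RadicialJungCleanModelsCleanLU3ArcPackage
import Literature.AlgebraicGeometry.Resolution.QuadraticTransforms
import HarnessLib

/-!
# Route `RadicialJung`, crux `CleanModels` (stmt-15917), stub `stub_cleanLU3DefectNonDiscrete`, sub-line (C-div): the SLICE — point
# blow-ups of the threefold along `O` over the quadratic sequence of the residue surface along `Ō`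

Line `Sketch` rev 24 of crux stmt-ResolutionOfSingularities-15917; lead `res-B-lead-1` g4 (workfile `Lines/Sketch_Cdiv_assembly.lean` v2,
piece SLICE).  OURS; nothing here proves resolution in characteristic `p`.

Setting: `O ≤ O₁` valuation rings of `K`, `κ₁ = ResidueField O₁`, `Ō = residueValuationSubring O O₁`, `im B` the residue image of a subring
`B ⊆ O` (`…CompositeResidue.lean`).  If a finitely generated model `Aₘ ⊆ O` has regular local ring `Rₘ = locAtCentre Aₘ O` whose image
`im Rₘ` is a local subring `R̄ₘ ⊆ κ₁` dominated by `Ō`, and `R̄ₘ₊₁` is the quadratic transform of `R̄ₘ` along `Ō`, then the quadratic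
transform `Rₘ₊₁` of `Rₘ` along `O` — again the regular local ring of a finitely generated model — has image `R̄ₘ₊₁` (`slice_step`): lift the
chart generator `x̄` of maximal `Ō`-value to `x ∈ 𝔪(Rₘ)`; it has maximal `O`-value (elements of `𝔪₁` are deeper than the `O₁`-unit `x`,
`O₁`-units compare through residues ✓ `valuation_le_of_residue_le`), so `Rₘ[𝔪/x]` localised is the transform along `O`, and its image is
`R̄ₘ[𝔪̄/x̄]` localised (✓ `residueImage_closure`, ✓ `residueImage_locAtCentre`).  Iterating from the frame (`slice`): along the whole quadratic
sequence `R̄ₙ` of the residue surface there are models `Aₙ ⊇ A` with `locAtCentre Aₙ O` regular, containing the frame ring, and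
`im (locAtCentre Aₙ O) = R̄ₙ`.
-/

noncomputable section

set_option linter.dupNamespace false -- mandated namespace of this single-conjunct summit

open IsLocalRing
open Literature.AlgebraicGeometry.Resolution

namespace Summit.ResolutionOfSingularities.ResolutionOfSingularities.Theorems.RadicialJung.CleanModels

variable {K : Type} [Field K] {k : Type} [Field k] [Algebra k K]

/-- For `x ∈ O` which is an `O₁`-unit and `y ∈ O`: `v y ≤ v x` implies `v̄ (res y) ≤ v̄ (res x)` (converse of ✓ `valuation_le_of_residue_le`).
[folklore] -/
theorem residue_le_of_valuation_le (O O₁ : ValuationSubring K) (h : O ≤ O₁) {x y : K} (hx : x ∈ O) (hy : y ∈ O)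
    (hvx : O₁.valuation x = 1) (hle : O.valuation y ≤ O.valuation x) :
    (residueValuationSubring O O₁ h).valuation (residue O₁ ⟨y, h hy⟩) ≤
      (residueValuationSubring O O₁ h).valuation (residue O₁ ⟨x, h hx⟩) := by
  set Ō := residueValuationSubring O O₁ h
  have hx0 : x ≠ 0 := ne_zero_of_valuation_eq_one hvx
  have hyx₁ : y / x ∈ O₁ := by
    rw [← O₁.valuation_le_one_iff, map_div₀, hvx, div_one, O₁.valuation_le_one_iff]; exact h hy
  have hyxO : y / x ∈ O := by
    rw [← O.valuation_le_one_iff, map_div₀]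
    exact div_le_one_of_le₀ hle zero_le
  have hres : residue O₁ ⟨y / x, hyx₁⟩ = residue O₁ ⟨y, h hy⟩ / residue O₁ ⟨x, h hx⟩ :=
    residue_div_eq O₁ O₁ le_rfl (h hy) (h hx) hvx
  have hmem : residue O₁ ⟨y / x, hyx₁⟩ ∈ Ō := (residue_mem_residueValuationSubring_iff O O₁ h _).mpr hyxO
  have hle1 : Ō.valuation (residue O₁ ⟨y / x, hyx₁⟩) ≤ 1 := (Ō.valuation_le_one_iff _).mpr hmem
  rw [hres, map_div₀] at hle1
  by_cases hrx0 : residue O₁ ⟨x, h hx⟩ = 0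
  · -- impossible: `x` is an `O₁`-unit
    rw [residue_eq_zero_iff] at hrx0
    have := (O₁.valuation_lt_one_iff _).mp hrx0
    exact absurd hvx (ne_of_lt this)
  · rwa [div_le_one₀ (zero_lt_iff.mpr ((Valuation.ne_zero_iff _).mpr hrx0))] at hle1

/-- **One step of the slice.**  See the module docstring. [folklore] -/
theorem slice_step (O O₁ : ValuationSubring K) (hOO₁ : O ≤ O₁)
    (A : Subalgebra k K) [IsFractionRing A K]
    (Aₘ : Subalgebra k K) (hAAₘ : A ≤ Aₘ) (hAₘfg : Aₘ.FG) (hAₘO : Aₘ.toSubring ≤ O.toSubring)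
    (hregm : IsRegularLocalRing (locAtCentre Aₘ.toSubring O))
    (Rb Rb' : Subring (ResidueField O₁))
    (hdom : SubringDominates Rb (residueValuationSubring O O₁ hOO₁).toSubring)
    (hstep : IsQuadraticTransformAlong (residueValuationSubring O O₁ hOO₁) Rb Rb')
    (himm : ((locAtCentre Aₘ.toSubring O).comap O₁.toSubring.subtype).map (residue O₁) = Rb) :
    ∃ A' : Subalgebra k K, A'.toSubring ≤ O.toSubring ∧ A ≤ A' ∧ A'.FG ∧
      IsRegularLocalRing (locAtCentre A'.toSubring O) ∧
      locAtCentre Aₘ.toSubring O ≤ locAtCentre A'.toSubring O ∧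
      ((locAtCentre A'.toSubring O).comap O₁.toSubring.subtype).map (residue O₁) = Rb' := by
  classical
  set Ō := residueValuationSubring O O₁ hOO₁ with hŌ
  set R : Subring K := locAtCentre Aₘ.toSubring O with hR
  haveI := hregm
  haveI : IsLocalRing R := inferInstance
  have hRO : R ≤ O.toSubring := locAtCentre_le hAₘO
  have hRO₁ : R ≤ O₁.toSubring := fun z hz => hOO₁ (hRO hz)
  have hRm : ∀ r : R, r ∈ maximalIdeal R ↔ O.valuation (r : K) < 1 := fun r => mem_maximalIdeal_locAtCentre_iff hAₘO r
  obtain ⟨hRbloc, xb, hxbm, hxb0, hxbmax, hRb'⟩ := hstep.exists_eq_locAtCentre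
  have hRbŌ : Rb ≤ Ō.toSubring := hdom.1
  have hRbm : ∀ s : Rb, s ∈ maximalIdeal Rb ↔ Ō.valuation (s : ResidueField O₁) < 1 :=
    (subringDominates_valuationSubring_iff hRbŌ).mp hdom
  -- residues of elements of `R`
  have hresmem : ∀ (z : K) (hz : z ∈ R), residue O₁ ⟨z, hRO₁ hz⟩ ∈ Rb := fun z hz =>
    himm ▸ residue_mem_residueImage O₁ R hRO₁ hz
  have hressurj : ∀ s ∈ Rb, ∃ (z : K) (hz : z ∈ R), residue O₁ ⟨z, hRO₁ hz⟩ = s := fun s hs =>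
    (mem_residueImage_iff O₁ R hRO₁ s).mp (himm ▸ hs : s ∈ (R.comap O₁.toSubring.subtype).map (residue O₁))
  -- maximal ideals correspond
  have hmax_of : ∀ (z : K) (hz : z ∈ R), O.valuation z < 1 →
      (⟨residue O₁ ⟨z, hRO₁ hz⟩, hresmem z hz⟩ : Rb) ∈ maximalIdeal Rb := by
    intro z hz hvz
    rw [hRbm]
    change Ō.valuation (residue O₁ ⟨z, hRO₁ hz⟩) < 1
    by_cases hz₁ : O₁.valuation z < 1
    · have : residue O₁ ⟨z, hRO₁ hz⟩ = 0 := by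
        rw [residue_eq_zero_iff]; exact (O₁.valuation_lt_one_iff _).mpr hz₁
      rw [this, map_zero]; exact zero_lt_one
    · exact (residue_valuation_lt_one_iff O O₁ hOO₁ (hRO hz)).mpr hvz
  have hval_of_max : ∀ (z : K) (hz : z ∈ R), (⟨residue O₁ ⟨z, hRO₁ hz⟩, hresmem z hz⟩ : Rb) ∈ maximalIdeal Rb →
      O.valuation z < 1 := by
    intro z hz hm
    rw [hRbm] at hm
    change Ō.valuation (residue O₁ ⟨z, hRO₁ hz⟩) < 1 at hm
    exact (residue_valuation_lt_one_iff O O₁ hOO₁ (hRO hz)).mp hm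
  -- lift the chart generator
  obtain ⟨x, hxR, hxres⟩ := hressurj (xb : ResidueField O₁) xb.2
  have hxO : x ∈ O := hRO hxR
  have hx₁ : O₁.valuation x = 1 := by
    apply le_antisymm ((O₁.valuation_le_one_iff _).mpr (hRO₁ hxR))
    by_contra hlt
    rw [not_le] at hlt
    have : residue O₁ ⟨x, hRO₁ hxR⟩ = 0 := by
      rw [residue_eq_zero_iff]; exact (O₁.valuation_lt_one_iff _).mpr hlt
    rw [this] at hxres
    exact hxb0 (Subtype.ext hxres.symm)
  have hxm : (⟨x, hxR⟩ : R) ∈ maximalIdeal R := by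
    rw [hRm]
    apply hval_of_max x hxR
    have : (⟨residue O₁ ⟨x, hRO₁ hxR⟩, hresmem x hxR⟩ : Rb) = xb := Subtype.ext hxres
    rw [this]; exact hxbm
  have hvx : O.valuation x < 1 := (hRm _).mp hxm
  have hx0 : x ≠ 0 := ne_zero_of_valuation_eq_one hx₁
  -- `x` has maximal `O`-value in `𝔪(R)`
  have hxmax : ∀ y : R, y ∈ maximalIdeal R → O.valuation (y : K) ≤ O.valuation x := by
    intro y hy
    by_cases hy₁ : O₁.valuation (y : K) < 1
    · exact (valuation_lt_of_le_of_valuation_lt O O₁ hOO₁ (x := (y : K)) (y := x) (by rw [hx₁]; exact hy₁)).le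
    · have hy₁' : O₁.valuation (y : K) = 1 := le_antisymm ((O₁.valuation_le_one_iff _).mpr (hRO₁ y.2)) (not_lt.mp hy₁)
      apply valuation_le_of_residue_le O O₁ hOO₁ (hRO y.2) hxO hx₁
      have hym := hmax_of (y : K) y.2 ((hRm y).mp hy)
      have := hxbmax _ hym
      rw [← hxres] at this
      exact this
  -- a finite generating set of `𝔪(R)` containing `x`
  obtain ⟨S, hS⟩ : (maximalIdeal R).FG := IsNoetherian.noetherian _
  let u : Finset R := insert ⟨x, hxR⟩ S
  have hu : Ideal.span (u : Set R) = maximalIdeal R := by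
    apply le_antisymm
    · rw [Ideal.span_le]
      intro z hz
      rcases Finset.mem_insert.mp hz with rfl | hz
      · exact hxm
      · exact hS ▸ Ideal.subset_span hz
    · rw [← hS]; exact Ideal.span_mono (Finset.subset_insert _ _)
  -- the quadratic transform of `R` along `O`
  set R' : Subring K := locAtCentre (blowupRing R x) O with hR'
  have hqt : IsQuadraticTransformAlong O R R' := by
    refine ⟨inferInstance, hRO, u, ⟨x, hxR⟩, hu, Finset.mem_insert_self _ _, fun h => hx0 (congrArg Subtype.val h),
      fun z hz => hxmax z (hu ▸ Ideal.subset_span hz), ?_⟩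
    rw [hR', blowupRing_eq_closure_of_span_eq x (u : Set R) hu]
  have hreg' : IsRegularLocalRing R' := hqt.isRegularLocalRing_of_isRegularLocalRing hregm
  have hlb : IsLocalBlowup O (locAtCentre Aₘ.toSubring O) R' := hqt.isLocalBlowup
  obtain ⟨A', hA'O, hAA', hA'fg, hR'A'⟩ := exists_model_of_isLocalBlowup hAAₘ hAₘfg hlb
  have hBO : blowupRing R x ≤ O.toSubring := (le_locAtCentre _ O).trans hqt.target_le
  have hBO₁ : blowupRing R x ≤ O₁.toSubring := fun z hz => hOO₁ (hBO hz)
  refine ⟨A', hA'O, hAA', hA'fg, hR'A' ▸ hreg', hR'A' ▸ hqt.le, ?_⟩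
  rw [← hR'A', hR', residueImage_locAtCentre O O₁ hOO₁ _ hBO, hRb']
  congr 1
  -- `im (R[𝔪/x]) = R̄[𝔪̄/x̄]`
  have hSO₁ : ((R : Set K) ∪ (fun y : R => (y : K) / x) '' (maximalIdeal R : Set R)) ⊆ O₁ := by
    rintro z (hz | ⟨y, hy, rfl⟩)
    · exact hRO₁ hz
    · exact hBO₁ (div_mem_blowupRing x hy)
  change ((Subring.closure _).comap O₁.toSubring.subtype).map (residue O₁) = Subring.closure _
  rw [residueImage_closure O₁ _ hSO₁]
  congr 1
  ext s
  simp only [Set.mem_image, Set.mem_preimage, Set.mem_union, SetLike.mem_coe]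
  constructor
  · rintro ⟨z, hz | ⟨y, hy, hyz⟩, rfl⟩
    · exact Or.inl (hresmem (z : K) hz)
    · refine Or.inr ⟨⟨residue O₁ ⟨(y : K), hRO₁ y.2⟩, hresmem _ y.2⟩, hmax_of _ y.2 ((hRm y).mp hy), ?_⟩
      have hz' : z = ⟨(y : K) / x, hBO₁ (div_mem_blowupRing x hy)⟩ := Subtype.ext hyz.symm
      change residue O₁ ⟨(y : K), hRO₁ y.2⟩ / (xb : ResidueField O₁) = residue O₁ z
      rw [hz', ← hxres]
      exact (residue_div_eq O₁ O₁ le_rfl (hRO₁ y.2) (hRO₁ hxR) hx₁).symm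
  · rintro (hs | ⟨yb, hyb, rfl⟩)
    · obtain ⟨z, hz, rfl⟩ := hressurj s hs
      exact ⟨⟨z, hRO₁ hz⟩, Or.inl hz, rfl⟩
    · obtain ⟨y, hy, hyres⟩ := hressurj (yb : ResidueField O₁) yb.2
      have hym : (⟨y, hy⟩ : R) ∈ maximalIdeal R := by
        rw [hRm]
        apply hval_of_max y hy
        have : (⟨residue O₁ ⟨y, hRO₁ hy⟩, hresmem y hy⟩ : Rb) = yb := Subtype.ext hyres
        rw [this]; exact hyb
      have hyx₁ : y / x ∈ O₁ := hBO₁ (div_mem_blowupRing x hym)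
      refine ⟨⟨y / x, hyx₁⟩, Or.inr ⟨⟨y, hy⟩, hym, rfl⟩, ?_⟩
      rw [← hyres, ← hxres]
      exact residue_div_eq O₁ O₁ le_rfl (hRO₁ hy) (hRO₁ hxR) hx₁

/-- **The slice.**  Along a quadratic sequence `R̄ : ℕ → Subring κ₁` of the residue surface along `Ō` (`R̄₀` dominated by `Ō`, each `R̄ₙ₊₁` the
quadratic transform of `R̄ₙ` along `Ō`) starting from the image of the regular local ring `locAtCentre A₁ O` of a finitely generated model
`A₁ ⊇ A`, there are finitely generated models `Aₙ ⊇ A` inside `O` with `locAtCentre Aₙ O` regular, containing `locAtCentre A₁ O`, and with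
residue image `R̄ₙ`. [folklore] -/
theorem slice (O O₁ : ValuationSubring K) (hOO₁ : O ≤ O₁)
    (A : Subalgebra k K) [IsFractionRing A K]
    (A₁ : Subalgebra k K) (hAA₁ : A ≤ A₁) (hA₁fg : A₁.FG) (hA₁O : A₁.toSubring ≤ O.toSubring)
    (hreg₁ : IsRegularLocalRing (locAtCentre A₁.toSubring O))
    (Rb : ℕ → Subring (ResidueField O₁))
    (h0 : ((locAtCentre A₁.toSubring O).comap O₁.toSubring.subtype).map (residue O₁) = Rb 0)
    (h0dom : SubringDominates (Rb 0) (residueValuationSubring O O₁ hOO₁).toSubring)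
    (hstep : ∀ n, IsQuadraticTransformAlong (residueValuationSubring O O₁ hOO₁) (Rb n) (Rb (n + 1))) (n : ℕ) :
    ∃ Aₙ : Subalgebra k K, Aₙ.toSubring ≤ O.toSubring ∧ A ≤ Aₙ ∧ Aₙ.FG ∧
      IsRegularLocalRing (locAtCentre Aₙ.toSubring O) ∧
      locAtCentre A₁.toSubring O ≤ locAtCentre Aₙ.toSubring O ∧
      ((locAtCentre Aₙ.toSubring O).comap O₁.toSubring.subtype).map (residue O₁) = Rb n := by
  induction n with
  | zero => exact ⟨A₁, hA₁O, hAA₁, hA₁fg, hreg₁, le_rfl, h0⟩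
  | succ n ih =>
    obtain ⟨Aₙ, hAₙO, hAAₙ, hAₙfg, hregn, hbase, himm⟩ := ih
    have hdom : SubringDominates (Rb n) (residueValuationSubring O O₁ hOO₁).toSubring := (sequence_dominates h0dom hstep n).1
    obtain ⟨A', hA'O, hAA', hA'fg, hreg', hle, himm'⟩ :=
      slice_step O O₁ hOO₁ A Aₙ hAAₙ hAₙfg hAₙO hregn (Rb n) (Rb (n + 1)) hdom (hstep n) himm
    exact ⟨A', hA'O, hAA', hA'fg, hreg', hbase.trans hle, himm'⟩

end Summit.ResolutionOfSingularities.ResolutionOfSingularities.Theorems.RadicialJung.CleanModels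

end
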